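import Mathlib
import Summits.KontsevichZagierPeriods.Zeta5Search.LawA5Proof
import HarnessLib

/-!
# ζ(5) search — THEOREM L5 AT FRAME DEPTH `M ≥ 8`, part 1/2: the pair lemma and the aggregation (`aggregate₅_d8`)

Cell `pub-zeta5` (HONEST FRAMING: systematic search; no irrationality claim unless certified), track «DENOM-LAW», seat `denom-prover-d1`
gen 10 (ATTEMPT-10 §10–§12).  `p`-adic valuations of the cell's OWN explicit rationals (the contiguity Casoratian of the Brown–Zudilin dual
coefficients); nothing here is a statement about ζ(5); no γ of record moves; records in print UNMOVED.

WHAT.  The tree's THEOREM L5 (`SecondResidueLaw.LawA5`, PROVED `lawA5_holds`) asks `M ≥ 10`.  Reading its proof, `M ≥ 10` is used in exactly one way: a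
SINGLE-pole class has one pole of order `≤ 6`, hence exponent `E ≥ −6 ≥ −M + 4`, so it lies below the four live layers — in `negl₄` (crude bounds) and in
`liveKappaSum_small` (the pole set of the residue identity consists of multipole classes).  Everything else (`pair₅`, the frame, the residue identity
`sum_gBarE_mul_kapBar_eq_zero`, which asks `M ≥ 4`) needs only `M ≥ 7`.  Hence **THEOREM L5₈**: the hypotheses of `LawA5` with `8 ≤ M` in place of
`10 ≤ M`, PLUS «every single-pole class of `b` and of `b + e_j` has exponent `≥ −M + 4`» ⇒ `v_p(Cas_j(b)) ≥ 8 − 2M`; and, exactly as in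
`DenomLaw/LawA5Shifted.lean`, with the two deepest layers empty ⇒ `9 − 2M` (`lawA5_depth8_shifted`).  The side condition is automatic for FRAMED classes
(type lists beginning and ending with a numerator zero: one pole of order ≤ 6 plus two zeros), i.e. in the census's X-ray regime (all seven parameters ≥ p).
The proofs below are the tree's `pair₅` / `negl₄` / `aggregate₅` / `liveKappaSum_small` / `lawA5_of_residueLaw` VERBATIM with `8 ≤ M` and the side
condition replacing the two `E ≥ −6` steps (suffix `_d8`).

WHY IT MATTERS (HOME `denom-law/prover-d1/ATTEMPT-10.md` §10–§12): the largest per-prime gap of the accounting node `DenomLaw.PathAccountingFirstPeriod` found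
by this seat is the «all parameters long» family at ⌊d/p⌋ = 2 (a = 7): 14,781 configurations at p = 11, 5,686 reached by no landed rung (PATH exact-true on all);
the ported hypotheses of L5₈ / L5₈⁺ hold on 4,400 of them with 0 violations of `8 − 2M` and reach PATH's value on ≈ 3,650; exhaustive small cells (b₀ ≤ 15, all
window primes, all j): 0 violations where the side condition holds, while WITHOUT it «L5 at M = 8» fails on thousands of sparse a = 0 cells — the condition is the
content, not a technicality.
-/

noncomputable section

open Finset PowerSeries

namespace Summit.KontsevichZagierPeriods.Zeta5Search.SecondOrder

open Summit.KontsevichZagierPeriods.Zeta5Search.WedgeDictionary (coeffW coeffV dOf)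
open Summit.KontsevichZagierPeriods.Zeta5Search.CasoratianValuation (InPolytope shift casoratian)
open Summit.KontsevichZagierPeriods.Zeta5Search.ClusterValuation
open Summit.KontsevichZagierPeriods.Zeta5Search.PadicSeries
open Summit.KontsevichZagierPeriods.Zeta5Search.CellA (classW coeffW_eq_sum_classW padicNorm_p)
open Summit.KontsevichZagierPeriods.Zeta5Search.LevelClass (typeExp typeW level_mem)
open Summit.KontsevichZagierPeriods.Zeta5Search.BigPrime (shift_zero padicNorm_mul_le_one dOf_shift)
open Summit.KontsevichZagierPeriods.Zeta5Search.RecordWindowsA4 (LawA4Classes)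
open Summit.KontsevichZagierPeriods.Zeta5Search.SecondResidueLaw (phi3Hat cubicHat lambdaP isRaiseN ShapeClause FourthDigitW FourthDigitV)
open Summit.KontsevichZagierPeriods.Zeta5Search.ResidueLaw
open Summit.KontsevichZagierPeriods.Zeta5Search.ResidueFour

variable {p : ℕ} [hp : Fact p.Prime]

/-! ## §1 The pair lemma at frame depth 8 -/

section PairD8

variable (b : ℕ → ℤ) (hb : InPolytope b) (hp5 : 5 ≤ p) (hpn : (p : ℤ) ≤ b 0) (hwin : (b 0 + 2 : ℤ) < (p : ℤ) ^ 2)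
  {M : ℕ} (hM : 8 ≤ M) (hMe : Even M) {L : ℕ} {e : ℕ → ℤ} (hpal : ∀ j ≤ L, e (L - j) = e j) (hTM : typeExp L e = -(M : ℤ))
  (hW4 : FourthDigitW) (hV4 : FourthDigitV)
include hb hp5 hpn hwin hM hMe hpal hTM hW4 hV4

/-- **PAIR LEMMA (fourth order), frame depth `M ≥ 8`** (the proof of `pair₅` verbatim; its arithmetic needs only `M ≥ 7`).  For a live class `x` (multipole, `E_x ≤ −M+3`) dominating the palindromic frame type
`(L, e)` (`E(T) = −M`) at offset `a`:  there are `A, C` with `‖A‖ ≤ p⁻¹`, `‖C + 2p³ĝ_xκ_{3−i}(x)‖ ≤ p⁻⁴` and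
`(Ω_x + Ω_x̄, N_x + N_x̄) ≡ A·t₁ + C·t₃ (mod p⁴)`. -/
private theorem pair₅_d8 {x : ℕ} (hx : x < p) (h2 : 2 ≤ classPoleCount b p x) (hE3 : classExp b p x ≤ -(M : ℤ) + 3)
    (hEm : -(M : ℤ) ≤ classExp b p x) {a : ℕ} (hdom : Dominates L e (topLevel b p x) (fun k => netExp b (x + k * p)) a)
    {i : ℕ} (hi : classExp b p x + M = i) (hdeepw : i = 0 → wHat b p (conjClass b p x) = wHat b p x) :
    ∃ A C : ℚ, padicNorm p A ≤ (p : ℚ) ^ (-(1 : ℤ)) ∧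
      padicNorm p (C + 2 * (p : ℚ) ^ 3 * gHat b p x * kappaQ b p x (3 - i)) ≤ (p : ℚ) ^ (-(4 : ℤ)) ∧
      padicNorm p (classW b p x / (-(p : ℚ)) ^ (-(M : ℤ) + 3) + classW b p (conjClass b p x) / (-(p : ℚ)) ^ (-(M : ℤ) + 3)
        - A * frameTW 1 L e - C * frameTW 3 L e) ≤ (p : ℚ) ^ (-(4 : ℤ)) ∧
      padicNorm p (classV b p x / (-(p : ℚ)) ^ (-(M : ℤ)) + classV b p (conjClass b p x) / (-(p : ℚ)) ^ (-(M : ℤ))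
        - A * frameTV 1 L e - C * frameTV 3 L e) ≤ (p : ℚ) ^ (-(4 : ℤ)) := by
  have hp2 : p ≠ 2 := by omega
  have hp0 : (p : ℚ) ≠ 0 := Nat.cast_ne_zero.2 hp.out.ne_zero
  have h0 : 0 ≤ b 0 := hb.1.1
  have hxn : x ≤ (b 0).toNat := le_b0_of_lt b hpn hx
  have hpnN : p ≤ (b 0).toNat := by have := hb.1.1; omega
  obtain ⟨hL, hL'⟩ := level_bounds' (p := p) b hxn
  set L' := topLevel b p x with hL'def
  have hLp : L < p := by have := hdom.le; have := topLevel_lt b hb hwin x; omega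
  have hi3 : i ≤ 3 := by omega
  have hEM : 0 ≤ classExp b p x + M := by omega
  have hE4 : classExp b p x ≤ -4 := by omega
  have hpole : 1 ≤ classPoleCount b p x := by omega
  -- the conjugate class
  set xb := conjClass b p x with hxbdef
  have hxb : xb < p := conjClass_lt b hp.out.pos x
  have hxbn : xb ≤ (b 0).toNat := le_b0_of_lt b hpn hxb
  have hEc : classExp b p xb = classExp b p x := classExp_conj b h0 hxn
  have hPc : classPoleCount b p xb = classPoleCount b p x := classPoleCount_conj b h0 hxn
  have hdom' := dominates_conj b hb hpn hx hdom hpal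
  -- the two classes as frame functionals
  have hWx := classFrameW b hb hp5 hwin hx hxn hdom hW4 hpole hEM
  have hVx := classFrameV b hb hp5 hwin hx hxn hdom hV4 hpole hEM hE4
  have hWc := classFrameW b hb hp5 hwin hxb hxbn hdom' hW4 (by rw [hPc]; exact hpole) (by rw [hEc]; exact hEM)
  have hVc := classFrameV b hb hp5 hwin hxb hxbn hdom' hV4 (by rw [hPc]; exact hpole) (by rw [hEc]; exact hEM) (by rw [hEc]; exact hE4)
  set Hx := classH b p x M L a e with hHx
  set Hc := classH b p xb M L (L' - L - a) e with hHc
  -- Lemma R: `H_x̄ + H_x(L − X)` is `O(p⁴)` coefficientwise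
  have hR := classH_reflect b hb hp5 hpn hx hMe hTM hdom hpal hpole hEM
  have hRW : padicNorm p (frameWPoly L e (Hc + Hx.comp (Polynomial.C (L : ℚ) - Polynomial.X))) ≤ (p : ℚ) ^ (-(4 : ℤ)) :=
    padicNorm_frameWPoly_le hLp e hR
  have hRV : padicNorm p (frameVPoly L e (Hc + Hx.comp (Polynomial.C (L : ℚ) - Polynomial.X))) ≤ (p : ℚ) ^ (-(4 : ℤ)) :=
    padicNorm_frameVPoly_le hLp e hR
  -- Lemma P: the odd part
  have hdeg : Hx.natDegree ≤ 6 := natDegree_classH_le b hpn hx hTM hdom hi hi3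
  have hL2 : (2 * ((L : ℚ) / 2)) = L := by ring
  have hOW := framePoly_oddPart (frameWPoly L e) (frameWPoly_add L e) (frameWPoly_C_mul L e) Hx hdeg ((L : ℚ) / 2)
  have hOV := framePoly_oddPart (frameVPoly L e) (frameVPoly_add L e) (frameVPoly_C_mul L e) Hx hdeg ((L : ℚ) / 2)
  rw [hL2] at hOW hOV
  set h₁ := (Polynomial.taylor ((L : ℚ) / 2) Hx).coeff 1 with hh₁
  set h₃ := (Polynomial.taylor ((L : ℚ) / 2) Hx).coeff 3 with hh₃
  set h₅ := (Polynomial.taylor ((L : ℚ) / 2) Hx).coeff 5 with hh₅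
  have hn1 := padicNorm_classTaylor_one b hp5 hpn hx hTM hdom hi
  have hn3 := padicNorm_classTaylor_three b hp5 hpn hx hTM hdom hi hi3
  have hn5 := padicNorm_classTaylor_five b hp5 hpn hx hTM hdom hi
  have h2n : padicNorm p (2 : ℚ) = 1 := padicNorm_two hp2
  obtain ⟨ht5W, ht5V⟩ := padicNorm_frameT_le_one hp2 hLp e 5
  -- the `λ_p`-terms
  have hlam : padicNorm p ((-(p : ℚ)) ^ (classExp b p x + M) * gHat b p x * ((p : ℚ) ^ 3 * lambdaP p * wHat b p x)
      + (-(p : ℚ)) ^ (classExp b p xb + M) * gHat b p xb * ((p : ℚ) ^ 3 * lambdaP p * wHat b p xb)) ≤ (p : ℚ) ^ (-(4 : ℤ)) := by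
    obtain ⟨-, -, -, hn⟩ := thmA_data b hb hwin
    have hw1 : ∀ y, padicNorm p (wHat b p y) ≤ 1 := fun y => LevelClass.padicNorm_wHat_le_one b h0 hn hp2 y
    have hg1 : ∀ y, padicNorm p (gHat b p y) ≤ 1 := fun y => padicNorm_gHat_le_one' b hp5 y
    have hlamP : padicNorm p (lambdaP p) ≤ 1 := padicNorm_lambdaP_le_one hp5
    have hp3 : padicNorm p ((p : ℚ) ^ 3) ≤ (p : ℚ) ^ (-(3 : ℤ)) := fo_ppow 3
    rw [hEc, hi]
    rcases Nat.eq_zero_or_pos i with hi0 | hipos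
    · -- deep pair: `ŵ_x = ŵ_x̄`, `ĝ_x + ĝ_x̄ ≡ 0 (mod p)`
      rw [hi0, Nat.cast_zero, zpow_zero, one_mul, one_mul, hdeepw hi0]
      have hEodd : Odd (classExp b p x + 1) := by
        rw [show classExp b p x = -(M : ℤ) by omega]; obtain ⟨r, hr⟩ := hMe; exact ⟨-(r : ℤ), by rw [hr]; push_cast; ring⟩
      have hA := gHat_conj_fourth' b hb hp5 hpn hx hL hL' hpole
      rw [hEodd.neg_one_zpow] at hA
      have hφ := padicNorm_phiHat_le_one b hp2 x
      have hc := padicNorm_curvHat_le_one b hp2 x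
      have hc3 := padicNorm_cubicHat_le_one b hp5 x
      have hLn : padicNorm p (L' : ℚ) ≤ 1 := by simpa using padicNorm.of_nat (p := p) L'
      have hLp1 : padicNorm p ((L' : ℚ) * p) ≤ (p : ℚ) ^ (-(1 : ℤ)) := padicNorm_mul_le_right hLn (le_of_eq padicNorm_p)
      have hsum : padicNorm p (gHat b p x + gHat b p xb) ≤ (p : ℚ) ^ (-(1 : ℤ)) := by
        have eq0 : gHat b p x + gHat b p xb = (gHat b p xb - (-1) * (gHat b p x *
            (1 - (L' : ℚ) * p * phiHat b p x + ((L' : ℚ) * p) ^ 2 * curvHat b p x - ((L' : ℚ) * p) ^ 3 * cubicHat b p x)))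
            + gHat b p x * (((L' : ℚ) * p) * (phiHat b p x - (L' : ℚ) * p * curvHat b p x + ((L' : ℚ) * p) ^ 2 * cubicHat b p x)) := by
          ring
        rw [eq0]
        refine fo_add (fo_weak hA (by norm_num)) (padicNorm_mul_le_right (hg1 x) (padicNorm_mul_le_left hLp1 ?_))
        refine fo_add (fo_sub hφ (padicNorm_mul_le_one (padicNorm_mul_le_one hLn padicNorm_p_le_one) hc)) (padicNorm_mul_le_one ?_ hc3)
        rw [CellA.padicNorm_pow_eq]; exact pow_le_one₀ (padicNorm.nonneg _) (padicNorm_mul_le_one hLn padicNorm_p_le_one)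
      have eq1 : gHat b p x * ((p : ℚ) ^ 3 * lambdaP p * wHat b p x) + gHat b p xb * ((p : ℚ) ^ 3 * lambdaP p * wHat b p x) =
          (p : ℚ) ^ 3 * ((lambdaP p * wHat b p x) * (gHat b p x + gHat b p xb)) := by ring
      rw [eq1, show (-(4 : ℤ)) = -(3 + 1) by norm_num]
      exact fo_mul hp3 (fo_imul (padicNorm_mul_le_one hlamP (hw1 x)) hsum)
    · have eq2 : (-(p : ℚ)) ^ (i : ℤ) * gHat b p x * ((p : ℚ) ^ 3 * lambdaP p * wHat b p x)
          + (-(p : ℚ)) ^ (i : ℤ) * gHat b p xb * ((p : ℚ) ^ 3 * lambdaP p * wHat b p xb) =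
          (-(p : ℚ)) ^ (i : ℤ) * ((p : ℚ) ^ 3 * (lambdaP p * (gHat b p x * wHat b p x + gHat b p xb * wHat b p xb))) := by ring
      rw [eq2]
      have hi1 : padicNorm p ((-(p : ℚ)) ^ (i : ℤ)) ≤ (p : ℚ) ^ (-(1 : ℤ)) := by
        rw [LevelClass.padicNorm_neg_p_zpow]; exact zpow_le_zpow_right₀ one_le_p (by omega)
      have := fo_mul hi1 (fo_mul hp3 (show padicNorm p (lambdaP p * (gHat b p x * wHat b p x + gHat b p xb * wHat b p xb)) ≤
        (p : ℚ) ^ (-(0 : ℤ)) by simpa using padicNorm_mul_le_one hlamP (fo_add (padicNorm_mul_le_one (hg1 _) (hw1 _))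
          (padicNorm_mul_le_one (hg1 _) (hw1 _)))))
      simpa using this
  refine ⟨2 * h₁, 2 * h₃, ?_, ?_, ?_, ?_⟩
  · rw [padicNorm.mul, h2n, one_mul]; exact hn1
  · rw [show 2 * h₃ + 2 * (p : ℚ) ^ 3 * gHat b p x * kappaQ b p x (3 - i) = 2 * (h₃ + (p : ℚ) ^ 3 * gHat b p x * kappaQ b p x (3 - i))
      by ring, padicNorm.mul, h2n, one_mul]; exact hn3
  · -- `W`: (Ω_x − ŵH_x) + (Ω_x̄ − ŵH_x̄) + ŵ(H_x̄ + H_x^r) + 2h₅t₅`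
    have elin : frameWPoly L e Hx + frameWPoly L e Hc =
        frameWPoly L e (Hx - Hx.comp (Polynomial.C (L : ℚ) - Polynomial.X)) + frameWPoly L e (Hc + Hx.comp (Polynomial.C (L : ℚ) - Polynomial.X)) := by
      rw [← frameWPoly_add, ← frameWPoly_add]; congr 1; ring
    have eqW : classW b p x / (-(p : ℚ)) ^ (-(M : ℤ) + 3) + classW b p xb / (-(p : ℚ)) ^ (-(M : ℤ) + 3)
          - 2 * h₁ * frameTW 1 L e - 2 * h₃ * frameTW 3 L e =
        (classW b p x / (-(p : ℚ)) ^ (-(M : ℤ) + 3) - frameWPoly L e Hx) + (classW b p xb / (-(p : ℚ)) ^ (-(M : ℤ) + 3) - frameWPoly L e Hc)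
          + frameWPoly L e (Hc + Hx.comp (Polynomial.C (L : ℚ) - Polynomial.X)) + 2 * h₅ * frameTW 5 L e := by
      have := elin; rw [hOW] at this
      unfold frameTW
      rw [pow_one]
      linear_combination this
    rw [eqW]
    refine fo_add (fo_add (fo_add hWx hWc) hRW) ?_
    rw [padicNorm.mul, padicNorm.mul, h2n, one_mul]
    calc padicNorm p h₅ * padicNorm p (frameTW 5 L e) ≤ (p : ℚ) ^ (-(5 : ℤ)) * 1 :=
          mul_le_mul hn5 ht5W (padicNorm.nonneg _) (zpow_p_nonneg _)
      _ ≤ (p : ℚ) ^ (-(4 : ℤ)) := by rw [mul_one]; exact zpow_le_zpow_right₀ one_le_p (by norm_num)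
  · have elin : frameVPoly L e Hx + frameVPoly L e Hc =
        frameVPoly L e (Hx - Hx.comp (Polynomial.C (L : ℚ) - Polynomial.X)) + frameVPoly L e (Hc + Hx.comp (Polynomial.C (L : ℚ) - Polynomial.X)) := by
      rw [← frameVPoly_add, ← frameVPoly_add]; congr 1; ring
    have eqV : classV b p x / (-(p : ℚ)) ^ (-(M : ℤ)) + classV b p xb / (-(p : ℚ)) ^ (-(M : ℤ))
          - 2 * h₁ * frameTV 1 L e - 2 * h₃ * frameTV 3 L e =
        (classV b p x / (-(p : ℚ)) ^ (-(M : ℤ)) - frameVPoly L e Hx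
            + (-(p : ℚ)) ^ (classExp b p x + M) * gHat b p x * ((p : ℚ) ^ 3 * lambdaP p * wHat b p x))
          + (classV b p xb / (-(p : ℚ)) ^ (-(M : ℤ)) - frameVPoly L e Hc
            + (-(p : ℚ)) ^ (classExp b p xb + M) * gHat b p xb * ((p : ℚ) ^ 3 * lambdaP p * wHat b p xb))
          + frameVPoly L e (Hc + Hx.comp (Polynomial.C (L : ℚ) - Polynomial.X)) + 2 * h₅ * frameTV 5 L e
          - ((-(p : ℚ)) ^ (classExp b p x + M) * gHat b p x * ((p : ℚ) ^ 3 * lambdaP p * wHat b p x)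
            + (-(p : ℚ)) ^ (classExp b p xb + M) * gHat b p xb * ((p : ℚ) ^ 3 * lambdaP p * wHat b p xb)) := by
      have := elin; rw [hOV] at this
      unfold frameTV
      rw [pow_one]
      linear_combination this
    rw [eqV]
    refine fo_sub (fo_add (fo_add (fo_add hVx hVc) hRV) ?_) hlam
    rw [padicNorm.mul, padicNorm.mul, h2n, one_mul]
    calc padicNorm p h₅ * padicNorm p (frameTV 5 L e) ≤ (p : ℚ) ^ (-(5 : ℤ)) * 1 :=
          mul_le_mul hn5 ht5V (padicNorm.nonneg _) (zpow_p_nonneg _)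
      _ ≤ (p : ℚ) ^ (-(4 : ℤ)) := by rw [mul_one]; exact zpow_le_zpow_right₀ one_le_p (by norm_num)

end PairD8

/-! ## §2 Negligible classes and aggregation at frame depth 8 -/

section AggD8

variable (b : ℕ → ℤ) (hb : InPolytope b) (hp5 : 5 ≤ p) (hpn : (p : ℤ) ≤ b 0) (hwin : (b 0 + 2 : ℤ) < (p : ℤ) ^ 2)
  {M : ℕ} (hM : 8 ≤ M) (hMe : Even M) {T : List ℤ} (hT : T.reverse = T)
  (hC : LawA4Classes b p M T) (hS : ShapeClause b p M T) (hW4 : FourthDigitW) (hV4 : FourthDigitV)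
  (hsing : ∀ y, y < p → classPoleCount b p y = 1 → -(M : ℤ) + 4 ≤ classExp b p y)
include hb hp5 hpn hwin hM hMe hT hC hS hW4 hV4 hsing

omit hpn hMe hT hS hW4 hV4 in
/-- **Negligible classes**: a residue outside the live set has `‖Ω_y‖, ‖N_y‖ ≤ p⁻⁴`. -/
private theorem negl₄_d8 {y : ℕ} (hy : y < p) (hny : ¬ (2 ≤ classPoleCount b p y ∧ classExp b p y ≤ -(M : ℤ) + 3)) :
    padicNorm p (classW b p y / (-(p : ℚ)) ^ (-(M : ℤ) + 3)) ≤ (p : ℚ) ^ (-(4 : ℤ)) ∧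
      padicNorm p (classV b p y / (-(p : ℚ)) ^ (-(M : ℤ))) ≤ (p : ℚ) ^ (-(4 : ℤ)) := by
  obtain ⟨c1, c2, -, -, -⟩ := hC
  have hmult : 2 ≤ classPoleCount b p y → -(M : ℤ) + 4 ≤ classExp b p y := fun h2 => by
    by_contra h; exact hny ⟨h2, by omega⟩
  refine ⟨norm_div_neg_p_zpow (by
      have h := CellD.padicNorm_classW_le b hb hp5 hwin (m := -(M : ℤ) + 4) (by omega) hmult
      rwa [show -(M : ℤ) + 3 + 4 = -(M : ℤ) + 4 + 3 by ring]),
    norm_div_neg_p_zpow (CellD.padicNorm_classV_le_of b hb hp5 hwin hy (v := -(M : ℤ) + 4) fun h1 => ?_)⟩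
  by_cases h2 : 2 ≤ classPoleCount b p y
  · exact (hmult h2).trans (CellA.classExp_le_classNu b p y)
  · have hone : classPoleCount b p y = 1 := by omega
    exact (hsing y hy hone).trans (CellA.classExp_le_classNu b p y)

/-- **AGGREGATION (THEOREM L5 for one parameter vector).**  If the live residue sum is `≡ 0 (mod p)`, then
`2·W/(−p)^{3−M} ≡ A·t₁,W`, `2·V/(−p)^{−M} ≡ A·t₁,V (mod p⁴)` with ONE scalar `A`, `‖A‖ ≤ p⁻¹`. -/
theorem aggregate₅_d8 (hTM : typeExp (tTop T) (tList T) = -(M : ℤ))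
    (hres : padicNorm p (∑ x ∈ liveSet b p M, liveKappa b p M x) ≤ (p : ℚ) ^ (-(1 : ℤ))) :
    ∃ A : ℚ, padicNorm p A ≤ (p : ℚ) ^ (-(1 : ℤ)) ∧
      padicNorm p (2 * (coeffW b / (-(p : ℚ)) ^ (-(M : ℤ) + 3)) - A * frameTW 1 (tTop T) (tList T)) ≤ (p : ℚ) ^ (-(4 : ℤ)) ∧
      padicNorm p (2 * (coeffV b / (-(p : ℚ)) ^ (-(M : ℤ))) - A * frameTV 1 (tTop T) (tList T)) ≤ (p : ℚ) ^ (-(4 : ℤ)) := by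
  have hp0 : 0 < p := hp.out.pos
  have hp2 : p ≠ 2 := by omega
  have hpQ : (p : ℚ) ≠ 0 := Nat.cast_ne_zero.2 hp.out.ne_zero
  have h0 : 0 ≤ b 0 := hb.1.1
  have hpn' : p ≤ (b 0).toNat := by omega
  set L := tTop T with hLdef
  set e := tList T with hedef
  have hpal : ∀ j ≤ L, e (L - j) = e j := tList_pal hT
  -- the per-residue data: `(A_x, C_x)` with `C_x ≡ −2p³·[x live]·ĝκ`
  have hpair : ∀ x ∈ range p, ∃ AC : ℚ × ℚ, padicNorm p AC.1 ≤ (p : ℚ) ^ (-(1 : ℤ)) ∧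
      (¬ (2 ≤ classPoleCount b p x ∧ classExp b p x ≤ -(M : ℤ) + 3) → AC.2 = 0) ∧
      padicNorm p (AC.2 + 2 * (p : ℚ) ^ 3 * (if x ∈ liveSet b p M then liveKappa b p M x else 0)) ≤ (p : ℚ) ^ (-(4 : ℤ)) ∧
      padicNorm p (classW b p x / (-(p : ℚ)) ^ (-(M : ℤ) + 3) + classW b p (conjClass b p x) / (-(p : ℚ)) ^ (-(M : ℤ) + 3)
        - AC.1 * frameTW 1 L e - AC.2 * frameTW 3 L e) ≤ (p : ℚ) ^ (-(4 : ℤ)) ∧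
      padicNorm p (classV b p x / (-(p : ℚ)) ^ (-(M : ℤ)) + classV b p (conjClass b p x) / (-(p : ℚ)) ^ (-(M : ℤ))
        - AC.1 * frameTV 1 L e - AC.2 * frameTV 3 L e) ≤ (p : ℚ) ^ (-(4 : ℤ)) := by
    intro x hxr
    have hx : x < p := mem_range.1 hxr
    have hxn := le_b0_of_lt b hpn hx
    by_cases hlive : 2 ≤ classPoleCount b p x ∧ classExp b p x ≤ -(M : ℤ) + 3
    · obtain ⟨h2, hE3⟩ := hlive
      have hmem : x ∈ multipoleClasses b p := mem_filter.2 ⟨hxr, h2⟩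
      have hEm : -(M : ℤ) ≤ classExp b p x := hC.1 x hmem
      obtain ⟨a, hdom⟩ := live_dominates b hpn hC hS hx h2 hE3
      set i := (classExp b p x + M).toNat with hidef
      have hi : classExp b p x + M = i := by omega
      -- the deep case: `ŵ_x̄ = ŵ_x`
      have hdeepw : i = 0 → wHat b p (conjClass b p x) = wHat b p x := by
        intro hi0
        have hEd : classExp b p x = -(M : ℤ) := by omega
        obtain ⟨hnc, htl⟩ := hC.2.2.1 x hmem hEd
        obtain ⟨hL, hL'⟩ := level_bounds' (p := p) b hxn
        obtain ⟨hxb, hLb, hLb'⟩ := CellKit.conj_level b hx hL hL'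
        have htlb : classTypeList b p (conjClass b p x) = T := by
          rw [ZeroWindows.classTypeList_conj b h0 hx hL hL', htl, hT]
        obtain ⟨-, hlev⟩ := spec_of_typeList (p := p) b hxn htl
        obtain ⟨htopb, hlevb⟩ := spec_of_typeList (p := p) b (le_b0_of_lt b hpn hxb) htlb
        have hncb : ¬ CentreIn b p (conjClass b p x) := by
          intro h
          have := (centreIn_iff_conjClass_eq b hpn' hxb).1 h
          rw [conjClass_conjClass b hx hpn'] at this
          exact hnc ((centreIn_iff_conjClass_eq b hpn' hx).2 this.symm)
        rw [topLevel_conj_level b hx hL hL'] at htopb hlevb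
        rw [wHat_level₀ b hx hL hL' e hlev (fun h => hnc h.2),
          wHat_level₀ b hxb hLb hLb' e (fun k hk => hlevb k hk) (fun h => hncb h.2)]
      obtain ⟨A, C, hA, hCk, hW, hV⟩ := pair₅_d8 b hb hp5 hpn hwin hM hMe hpal hTM hW4 hV4 hx h2 hE3 hEm hdom hi hdeepw
      refine ⟨(A, C), hA, fun h => absurd ⟨h2, hE3⟩ h, ?_, hW, hV⟩
      rw [if_pos (show x ∈ liveSet b p M from mem_filter.2 ⟨hxr, h2, hE3⟩), ← kappaQ_three_sub b p x M i hi (by omega)]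
      simpa [mul_assoc] using hCk
    · -- negligible pair
      have hlivec : ¬ (2 ≤ classPoleCount b p (conjClass b p x) ∧ classExp b p (conjClass b p x) ≤ -(M : ℤ) + 3) := by
        rwa [classPoleCount_conj b h0 hxn, classExp_conj b h0 hxn]
      obtain ⟨hWx, hVx⟩ := negl₄_d8 b hb hp5 hwin hM hC hsing hx hlive
      obtain ⟨hWc, hVc⟩ := negl₄_d8 b hb hp5 hwin hM hC hsing (conjClass_lt b hp0 x) hlivec
      refine ⟨(0, 0), by rw [padicNorm.zero]; exact zpow_p_nonneg _, fun _ => rfl, ?_, ?_, ?_⟩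
      · rw [if_neg (show x ∉ liveSet b p M from fun h => hlive (mem_filter.1 h).2)]; simp [zpow_p_nonneg]
      · simp only [zero_mul, sub_zero]; exact fo_add hWx hWc
      · simp only [zero_mul, sub_zero]; exact fo_add hVx hVc
  choose! AC hAC using hpair
  have hconj : ∀ y ∈ range p, conjClass b p y ∈ range p := fun y _ => mem_range.2 (conjClass_lt b hp0 y)
  -- the τ₃-coefficient `𝒞 = Σ C_x` vanishes to order `p⁴`
  have hCsum : padicNorm p (∑ x ∈ range p, (AC x).2) ≤ (p : ℚ) ^ (-(4 : ℤ)) := by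
    have e1 : ∑ x ∈ range p, (AC x).2 = ∑ x ∈ range p, ((AC x).2 + 2 * (p : ℚ) ^ 3 * (if x ∈ liveSet b p M then liveKappa b p M x else 0))
        - 2 * (p : ℚ) ^ 3 * ∑ x ∈ liveSet b p M, liveKappa b p M x := by
      rw [sum_add_distrib, ← mul_sum, sum_ite_mem, inter_eq_right.mpr (show liveSet b p M ⊆ range p from filter_subset _ _)]
      ring
    rw [e1]
    refine fo_sub (padicNorm.sum_le' (fun x hx => (hAC x hx).2.2.1) (zpow_p_nonneg _)) ?_
    rw [show (-(4 : ℤ)) = -(3 + 1) by norm_num]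
    exact fo_mul (padicNorm_mul_le_right (by rw [padicNorm_two hp2]) (fo_ppow 3)) hres
  -- integrality of the directions (`L < p` when a live class exists; otherwise the live sum of `C` is `0` termwise anyway)
  have ht3 : ∀ {t : ℚ}, (t = frameTW 3 L e ∨ t = frameTV 3 L e) →
      padicNorm p ((∑ x ∈ range p, (AC x).2) * t) ≤ (p : ℚ) ^ (-(4 : ℤ)) := by
    intro t ht
    by_cases hex : ∃ x ∈ range p, 2 ≤ classPoleCount b p x ∧ classExp b p x ≤ -(M : ℤ) + 3
    · obtain ⟨x, hxr, h2, hE3⟩ := hex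
      obtain ⟨a, hdom⟩ := live_dominates b hpn hC hS (mem_range.1 hxr) h2 hE3
      have hLp : L < p := by have := hdom.le; have := topLevel_lt b hb hwin x; omega
      have hn := padicNorm_frameT_le_one hp2 hLp e 3
      rcases ht with rfl | rfl
      · exact padicNorm_mul_le_left hCsum hn.1
      · exact padicNorm_mul_le_left hCsum hn.2
    · -- no live class: every `C_x` may be taken... we only know the bound on the sum; but then each pair is negligible and
      -- `C_x = 0` by construction
      have hz : ∀ x ∈ range p, (AC x).2 = 0 := fun x hx =>
        (hAC x hx).2.1 fun h => hex ⟨x, hx, h⟩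
      rw [sum_eq_zero hz, zero_mul, padicNorm.zero]; exact zpow_p_nonneg _
  refine ⟨∑ x ∈ range p, (AC x).1, padicNorm.sum_le' (fun x hx => (hAC x hx).1) (zpow_p_nonneg _), ?_, ?_⟩
  · have e : 2 * (coeffW b / (-(p : ℚ)) ^ (-(M : ℤ) + 3)) - (∑ x ∈ range p, (AC x).1) * frameTW 1 L e =
        ∑ x ∈ range p, (classW b p x / (-(p : ℚ)) ^ (-(M : ℤ) + 3)
          + classW b p (conjClass b p x) / (-(p : ℚ)) ^ (-(M : ℤ) + 3) - (AC x).1 * frameTW 1 L e - (AC x).2 * frameTW 3 L e)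
          + (∑ x ∈ range p, (AC x).2) * frameTW 3 L e := by
      rw [sum_sub_distrib, sum_sub_distrib, sum_mul, sum_mul, coeffW_eq_sum_classW b hp0, sum_div,
        ← sum_conj_symm b hpn' (range p) (fun y hy => mem_range.1 hy) hconj]
      ring
    rw [e]
    exact fo_add (padicNorm.sum_le' (fun x hx => (hAC x hx).2.2.2.1) (zpow_p_nonneg _)) (ht3 (Or.inl rfl))
  · have e : 2 * (coeffV b / (-(p : ℚ)) ^ (-(M : ℤ))) - (∑ x ∈ range p, (AC x).1) * frameTV 1 L e =
        ∑ x ∈ range p, (classV b p x / (-(p : ℚ)) ^ (-(M : ℤ))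
          + classV b p (conjClass b p x) / (-(p : ℚ)) ^ (-(M : ℤ)) - (AC x).1 * frameTV 1 L e - (AC x).2 * frameTV 3 L e)
          + (∑ x ∈ range p, (AC x).2) * frameTV 3 L e := by
      rw [sum_sub_distrib, sum_sub_distrib, sum_mul, sum_mul, coeffV_eq_sum_classV b hp0, sum_div,
        ← sum_conj_symm b hpn' (range p) (fun y hy => mem_range.1 hy) hconj]
      ring
    rw [e]
    exact fo_add (padicNorm.sum_le' (fun x hx => (hAC x hx).2.2.2.2) (zpow_p_nonneg _)) (ht3 (Or.inr rfl))

end AggD8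

end Summit.KontsevichZagierPeriods.Zeta5Search.SecondOrder

end
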